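import Mathlib
import Summits.Ventures.PercRepro2.SkeletonDegree

/-!
# Nonzero neighbours never multiply along a reduction; (HCOV) on necklaces (blind cell PercRepro2,
night-1 g16; NIGHT1-G16.md §5)

The neighbour form of SkeletonDegree.lean: `nzNbr p ends v` = the vertices joined to `v` by a nonzero
edge.  **`card_nzNbr_le_of_step` / `card_nzNbr_le_of_reduces`**: its cardinality never grows along a
reduction (parallel edges and loops are invisible to it, so this is the statement that survives the
merge).  **`HCov_of_card_nzNbr_le_two`**: if every unmarked vertex has at most two nonzero
neighbours, (HCOV) holds — cycles and NECKLACES with the five marks placed anywhere (S3.7 (C7)),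
with any multiplicities and loops, are instances: in the Simple reduct an unmarked vertex with a
nonzero edge would have three distinct nonzero neighbours.

Own code; standard axioms.
-/

open scoped Classical

namespace Summit.Ventures.PercRepro2

open UnionCluster CovForm

namespace Skeleton

section Erase

/-- A set contained in `S` with `f'` removed and `f` possibly added — where `f` can be present only
if `f'` was in `S` or `f` itself was — is not larger than `S` (any type). -/
lemma card_le_of_subset_erase_insert' {α : Type*} [DecidableEq α] {S T : Finset α} {f f' : α}
    (hsub : T ⊆ insert f (S.erase f')) (hf : f ∈ T → f' ∈ S ∨ f ∈ S.erase f') :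
    T.card ≤ S.card := by
  by_cases hfT : f ∈ T
  · rcases hf hfT with hf'S | hfS
    · calc T.card ≤ (insert f (S.erase f')).card := Finset.card_le_card hsub
        _ ≤ (S.erase f').card + 1 := Finset.card_insert_le _ _
        _ = S.card := by
          rw [Finset.card_erase_of_mem hf'S]
          have := Finset.card_pos.2 ⟨f', hf'S⟩
          omega
    · rw [Finset.insert_eq_of_mem hfS] at hsub
      calc T.card ≤ (S.erase f').card := Finset.card_le_card hsub
        _ ≤ S.card := Finset.card_erase_le
  · have hsub' : T ⊆ S.erase f' := by
      intro e he
      have := hsub he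
      rw [Finset.mem_insert] at this
      rcases this with rfl | h
      · exact absurd he hfT
      · exact h
    calc T.card ≤ (S.erase f').card := Finset.card_le_card hsub'
      _ ≤ S.card := Finset.card_erase_le

end Erase

section NbrDefs

variable {V : Type*} {E : Type*} [Fintype V] {R : Type*} [Field R]

/-- The nonzero neighbours of `v`: the vertices `y` with a nonzero edge `{v, y}` (`v` itself for a
nonzero loop). -/
noncomputable def nzNbr (p : E → R) (ends : E → Sym2 V) (v : V) : Finset V :=
  Finset.univ.filter (fun y => ∃ e, p e ≠ 0 ∧ ends e = s(v, y))

/-- Membership in `nzNbr`. -/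
lemma mem_nzNbr {p : E → R} {ends : E → Sym2 V} {v y : V} :
    y ∈ nzNbr p ends v ↔ ∃ e, p e ≠ 0 ∧ ends e = s(v, y) := by
  simp [nzNbr]

end NbrDefs

section Neighbours

variable {V : Type*} {E : Type*} [Fintype E] [DecidableEq E] [Fintype V] [DecidableEq V]
  {R : Type*} [Field R] [LinearOrder R] [IsStrictOrderedRing R]

omit [Fintype E] [DecidableEq V] [LinearOrder R] [IsStrictOrderedRing R] in
/-- Zeroing an edge removes neighbours only. -/
lemma nzNbr_update_zero_subset (p : E → R) (ends : E → Sym2 V) (f : E) (v : V) :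
    nzNbr (Function.update p f 0) ends v ⊆ nzNbr p ends v := by
  intro y hy
  rw [mem_nzNbr] at hy ⊢
  obtain ⟨e, he, hey⟩ := hy
  refine ⟨e, ?_, hey⟩
  intro h0; apply he
  by_cases hef : e = f
  · subst hef; simp
  · rw [Function.update_of_ne hef]; exact h0

omit [Fintype E] [DecidableEq E] [DecidableEq V] [LinearOrder R] [IsStrictOrderedRing R] in
/-- Re-routing the zero-weight edges keeps the nonzero neighbours. -/
lemma nzNbr_congr_nz (p : E → R) {ends ends' : E → Sym2 V} (h : ∀ e, p e ≠ 0 → ends e = ends' e)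
    (v : V) : nzNbr p ends' v = nzNbr p ends v := by
  ext y
  rw [mem_nzNbr, mem_nzNbr]
  constructor
  · rintro ⟨e, he, hey⟩; exact ⟨e, he, by rw [h e he]; exact hey⟩
  · rintro ⟨e, he, hey⟩; exact ⟨e, he, by rw [← h e he]; exact hey⟩

omit [Fintype E] [DecidableEq V] [IsStrictOrderedRing R] in
/-- The merge of two parallel edges removes neighbours only. -/
lemma nzNbr_merge_subset (p : E → R) (ends : E → Sym2 V) {e₁ e₂ : E} (hne : e₁ ≠ e₂)
    (hpar : ends e₁ = ends e₂) (v : V) :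
    nzNbr (Function.update (Function.update p e₁ (1 - (1 - p e₁) * (1 - p e₂))) e₂ 0) ends v ⊆
      nzNbr p ends v := by
  intro y hy
  rw [mem_nzNbr] at hy ⊢
  obtain ⟨e, he, hey⟩ := hy
  by_cases he2 : e = e₂
  · subst he2; simp at he
  rw [Function.update_of_ne he2] at he
  by_cases he1 : e = e₁
  · subst he1
    rw [Function.update_self] at he
    by_cases h2 : p e₂ = 0
    · refine ⟨e, ?_, hey⟩
      intro h0; apply he; rw [h0, h2]; ring
    · exact ⟨e₂, h2, by rw [← hpar]; exact hey⟩
  · rw [Function.update_of_ne he1] at he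
    exact ⟨e, he, hey⟩

omit [Fintype E] [LinearOrder R] [IsStrictOrderedRing R] in
/-- The series contraction at `x` (exactly the edges `f = {x, w}`, `f' = {x, w'}` at `x`) does not
raise the number of nonzero neighbours of any vertex. -/
lemma card_nzNbr_series_le (p : E → R) (ends : E → Sym2 V) {f f' : E} {x w w' : V} (hff : f ≠ f')
    (hf : ends f = s(x, w)) (hf' : ends f' = s(x, w')) (hdeg : ∀ e, x ∈ ends e → e = f ∨ e = f')
    (v : V) :
    (nzNbr (Function.update (Function.update p f (p f * p f')) f' 0)
        (Function.update ends f s(w, w')) v).card ≤ (nzNbr p ends v).card := by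
  by_cases hv : v = w ∨ v = w'
  · -- at an end of the contracted edge: the far end `z'` may be new, the vertex `x` is lost
    obtain ⟨z', hz'⟩ : ∃ z', s(w, w') = s(v, z') := by
      rcases hv with rfl | rfl
      · exact ⟨w', rfl⟩
      · exact ⟨w, Sym2.eq_swap⟩
    refine card_le_of_subset_erase_insert' (f := z') (f' := x) ?_ ?_
    · intro y hy
      rw [mem_nzNbr] at hy
      obtain ⟨e, he, hey⟩ := hy
      rw [Finset.mem_insert, Finset.mem_erase, mem_nzNbr]
      by_cases hef : e = f
      · subst hef
        left
        rw [Function.update_self, hz'] at hey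
        exact (Sym2.congr_right.1 hey).symm
      · have hef' : e ≠ f' := by intro hh; subst hh; simp at he
        rw [Function.update_of_ne hef', Function.update_of_ne hef] at he
        rw [Function.update_of_ne hef] at hey
        right
        refine ⟨?_, e, he, hey⟩
        intro hyx
        subst hyx
        rcases hdeg e (by rw [hey]; exact Sym2.mem_mk_right v y) with hh | hh
        · exact hef hh
        · exact hef' hh
    · intro hz
      rw [mem_nzNbr] at hz
      obtain ⟨e, he, hey⟩ := hz
      by_cases hef : e = f
      · subst hef
        left
        rw [Function.update_of_ne hff, Function.update_self] at he
        have hne : p e ≠ 0 ∧ p f' ≠ 0 := by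
          constructor
          · intro h0; apply he; rw [h0]; ring
          · intro h0; apply he; rw [h0]; ring
        rw [mem_nzNbr]
        rcases hv with rfl | rfl
        · exact ⟨e, hne.1, by rw [hf]; exact Sym2.eq_swap⟩
        · exact ⟨f', hne.2, by rw [hf']; exact Sym2.eq_swap⟩
      · have hef' : e ≠ f' := by intro hh; subst hh; simp at he
        rw [Function.update_of_ne hef', Function.update_of_ne hef] at he
        rw [Function.update_of_ne hef] at hey
        right
        rw [Finset.mem_erase, mem_nzNbr]
        refine ⟨?_, e, he, hey⟩
        intro hzx
        subst hzx
        rcases hdeg e (by rw [hey]; exact Sym2.mem_mk_right v z') with hh | hh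
        · exact hef hh
        · exact hef' hh
  · -- elsewhere the neighbours do not change
    apply Finset.card_le_card
    intro y hy
    rw [mem_nzNbr] at hy ⊢
    obtain ⟨e, he, hey⟩ := hy
    have hef : e ≠ f := by
      intro hh; subst hh
      rw [Function.update_self] at hey
      have hvm : v ∈ s(w, w') := by rw [hey]; exact Sym2.mem_mk_left v y
      exact hv (Sym2.mem_iff.1 hvm)
    have hef' : e ≠ f' := by intro hh; subst hh; simp at he
    rw [Function.update_of_ne hef', Function.update_of_ne hef] at he
    rw [Function.update_of_ne hef] at hey
    exact ⟨e, he, hey⟩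

variable {o a₁ a₂ a₃ b : V}

omit [Fintype E] [IsStrictOrderedRing R] in
/-- **The number of nonzero neighbours of any vertex never grows under a skeleton move.** -/
theorem card_nzNbr_le_of_step {I J : (E → R) × (E → Sym2 V)} (h : Step o a₁ a₂ a₃ b I J) (v : V) :
    (nzNbr J.1 J.2 v).card ≤ (nzNbr I.1 I.2 v).card := by
  cases h with
  | @reroute p _ _ hr => exact le_of_eq (by rw [nzNbr_congr_nz p hr v])
  | @loop p ends e _ _ => exact Finset.card_le_card (nzNbr_update_zero_subset p ends e v)
  | @leaf p ends f _ _ _ _ _ _ _ _ _ _ => exact Finset.card_le_card (nzNbr_update_zero_subset p ends f v)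
  | @series p ends f f' _ _ _ hff hf hf' hdeg _ _ _ _ _ _ _ =>
    exact card_nzNbr_series_le p ends hff hf hf' hdeg v
  | @merge p ends _ _ hne hpar => exact Finset.card_le_card (nzNbr_merge_subset p ends hne hpar v)

omit [Fintype E] [IsStrictOrderedRing R] in
/-- **The number of nonzero neighbours of any vertex never grows along a reduction.** -/
theorem card_nzNbr_le_of_reduces {I J : (E → R) × (E → Sym2 V)} (h : Reduces o a₁ a₂ a₃ b I J)
    (v : V) : (nzNbr J.1 J.2 v).card ≤ (nzNbr I.1 I.2 v).card := by
  induction h with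
  | refl => exact le_rfl
  | tail _ hbc ih => exact le_trans (card_nzNbr_le_of_step hbc v) ih

/-- **(HCOV) without unmarked branch vertices, neighbour form**: if every unmarked vertex has at most
two nonzero neighbours (parallel edges and loops allowed — necklaces) and the five marks are distinct,
(HCOV) holds. -/
theorem HCov_of_card_nzNbr_le_two (p : E → R) (ends : E → Sym2 V) (hp : IsProbVec p)
    (hinj : Function.Injective (Hub3.markOf3 o a₁ a₂ a₃ b))
    (hnbr : ∀ v, v ≠ o → v ≠ a₁ → v ≠ a₂ → v ≠ a₃ → v ≠ b → (nzNbr p ends v).card ≤ 2) :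
    HCov p ends o a₁ a₂ a₃ b := by
  obtain ⟨J, hJ, hJs⟩ := exists_reduces_simple o a₁ a₂ a₃ b p ends hp
  obtain ⟨q, ends'⟩ := J
  refine HCov_of_reduces_marks_at_a3 hp hJ hinj ?_
  intro e he hae
  obtain ⟨y, hy⟩ := Sym2.mem_iff_exists.1 hae
  suffices hmark : ∃ m, y = Hub3.markOf3 o a₁ a₂ a₃ b m by
    obtain ⟨m, rfl⟩ := hmark
    exact ⟨m, hy⟩
  by_contra hy'
  have hyo : y ≠ o := fun hh => hy' ⟨Hub.Mark.o, by rw [hh]; rfl⟩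
  have hy1 : y ≠ a₁ := fun hh => hy' ⟨Hub.Mark.a₁, by rw [hh]; rfl⟩
  have hy2 : y ≠ a₂ := fun hh => hy' ⟨Hub.Mark.a₂, by rw [hh]; rfl⟩
  have hy3 : y ≠ a₃ := fun hh => hy' ⟨Hub.Mark.a₃, by rw [hh]; rfl⟩
  have hyb : y ≠ b := fun hh => hy' ⟨Hub.Mark.b, by rw [hh]; rfl⟩
  have hle : (nzNbr q ends' y).card ≤ 2 :=
    le_trans (card_nzNbr_le_of_reduces (I := (p, ends)) (J := (q, ends')) hJ y)
      (hnbr y hyo hy1 hy2 hy3 hyb)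
  -- in the simple reduct `y` has a nonzero edge, hence nonzero-degree `≥ 3`: three distinct nonzero
  -- edges at `y` with pairwise distinct far ends (no parallel pair), so three nonzero neighbours
  obtain ⟨hred, -, hnopar⟩ := hJs
  dsimp only at hred hnopar
  have hs := (hred y hyo hy1 hy2 hy3 hyb).2
  have hpos : 1 ≤ nzDeg q ends' y := by
    rw [nzDeg_eq_card]
    exact Finset.card_pos.2 ⟨e, mem_nzAt.2 ⟨by rw [hy]; exact Sym2.mem_mk_right a₃ y, he⟩⟩
  have h3 : 2 < nzDeg q ends' y := by rcases hs with h0 | h3 <;> omega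
  rw [nzDeg_eq_card, Finset.two_lt_card] at h3
  obtain ⟨e₁, h1, e₂, h2, e₃, h3', h12, h13, h23⟩ := h3
  rw [mem_nzAt] at h1 h2 h3'
  obtain ⟨y₁, hy₁⟩ := Sym2.mem_iff_exists.1 h1.1
  obtain ⟨y₂, hy₂⟩ := Sym2.mem_iff_exists.1 h2.1
  obtain ⟨y₃, hy₃⟩ := Sym2.mem_iff_exists.1 h3'.1
  have hne : ∀ {ea eb : E} {ya yb : V}, q ea ≠ 0 → q eb ≠ 0 → ea ≠ eb → ends' ea = s(y, ya) →
      ends' eb = s(y, yb) → ya ≠ yb := by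
    intro ea eb ya yb ha hb hab hea heb hyy
    exact hnopar ea eb ha hb hab (by rw [hea, heb, hyy])
  have hsub : ({y₁, y₂, y₃} : Finset V) ⊆ nzNbr q ends' y := by
    intro z hz
    simp only [Finset.mem_insert, Finset.mem_singleton] at hz
    rw [mem_nzNbr]
    rcases hz with rfl | rfl | rfl
    · exact ⟨e₁, h1.2, hy₁⟩
    · exact ⟨e₂, h2.2, hy₂⟩
    · exact ⟨e₃, h3'.2, hy₃⟩
  have hcard : ({y₁, y₂, y₃} : Finset V).card = 3 := by
    rw [Finset.card_insert_of_notMem, Finset.card_insert_of_notMem, Finset.card_singleton]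
    · simpa using hne h2.2 h3'.2 h23 hy₂ hy₃
    · simp only [Finset.mem_insert, Finset.mem_singleton, not_or]
      exact ⟨hne h1.2 h2.2 h12 hy₁ hy₂, hne h1.2 h3'.2 h13 hy₁ hy₃⟩
  have := Finset.card_le_card hsub
  omega

end Neighbours

end Skeleton

end Summit.Ventures.PercRepro2
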